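/-
Copyright (c) 2026 the pub-hodgecm-mathlib formalisation cell (harness21).  Prover seat hodgecm-mathlib-K2E1-p02 (g6), Track B ∕ K2-LIT (build stream 29),
h413 = `stmt-HodgeConjecture-24833`, line `K2_E1_TraceFormulaBeta`, campaign «EIS-R7-BL-SPH-2» (Bernstein–Lapid soft continuation), file P6′ §3 = item (i) of the dealer's RULING
2026-09-04T09:23:38Z («a HOMOGENEOUS solution is in `L²(μ)`») — the discharge of the `L²`-letter `hL2` of ★∕📤 P6′ §2 `K2E1BLUniquenessSelfAdjointU2.hunq_of_memLp_{of_lt,two}`.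
-/
import Summits.HodgeConjecture.HodgeConjecture.Theorems.K2E1BLIotaBoundU2           -- ★ p858831 (K2E1-p08 g6): CM covering comparison LOWER∕UPPER (`…lintegral…comp_pZX…_cm`), `measurable_supHeight_inv_pow`
import Summits.HodgeConjecture.HodgeConjecture.Theorems.K2E1BLShiftBoundU2          -- ★ (K2E1-p11): `ae_weightedTruncMeasure_iff`, `rightConvFun_congr_ae_restrict` (via ★ `K2E1BLRightConvTonelliU2`)
import Summits.HodgeConjecture.HodgeConjecture.Theorems.K2E1BLSpacesU2              -- ★ p858804 (K2E4-p10 g5) P2a-A: `sub_cnstN_mem_HNcusp`, `coeFn_restrHN`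
import Summits.HodgeConjecture.HodgeConjecture.Theorems.K2E1TruncatedCuspCompactU2  -- ★ (K2E1-p11) K2: `ae_lt_borelQuotHeight_weightedTruncMeasure`, `measurableSet_lt_borelQuotHeight` (+ the `hK1` letter shape)
import HarnessLib

/-!
# h413 ∕ Track B «K2-LIT», campaign «EIS-R7-BL-SPH-2» — file P6′ §3 `K2E1BLHomogeneousL2U2`: A HOMOGENEOUS SOLUTION OF THE `𝔛`-SYSTEM IS IN `L²(G(F)∖G(𝔸), μ)` — the discharge
# of the `L²`-letter `hL2` of the «L² + SELF-ADJOINT» uniqueness (★∕📤 P6′ §2 `hunq_of_memLp_of_lt` ∕ `hunq_of_memLp_two`)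

Cell `pub/hodgecm-mathlib`, crux H413 = `stmt-HodgeConjecture-24833`, route of record `HCCMUnconditional`; chair K2-lead (g1), dealer K2E1-plan (g5), RULING 09:23:38Z item (i)
`memLp_two_of_homogeneous_solution`; REPORT-FIRST heads 2026-09-04 ~09:50Z.  SETTING (★ leaves 1–2): `𝔛 = G(F)∖G(𝔸)` with an automorphic measure `μ`, `X = 𝓗_k(𝔛) = HX k μ`;
`Z = B(F)∖G(𝔸)`, the truncated weighted spaces `𝓗_k(Z_c) = HN k c μZ` (`weightedTruncMeasure k c μZ = HZ^{−2k}·μZ|_{Z_c}`); the pull-back `ι = iota hb : X →L 𝓗_k(Z_a)` along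
`p : Z → 𝔛` (letter `IotaBound`), the constant term `cnstN`, its kernel `HNcusp`, the restriction `restrHN` and Bernstein–Lapid's `δ(h) = deltaShift hs : 𝓗_k(Z_a) →L 𝓗_k(Z_{a₀})`
(letter `ShiftBound`, a.e. the right convolution `rightConvFun νG h`).  A HOMOGENEOUS solution at `z` is `ψ ∈ X` with `T ψ = λ•ψ` (`λ = ĥ(z) ≠ 0`, `T` the `𝔛`-side Hecke operator with
P3-C's intertwining `hδι : δ ∘ ι = restr ∘ ι ∘ T`, ★ `deltaShift_comp_iota`) and constant term `cnstN (ιψ) = b'•α₂` (`α₂ = α₂(z)` the class of `H^{ρ₀−z}`).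

THE ARGUMENT [BernsteinLapid2019, §4 Claim 2 (p. 9) with Claim 5 (p. 10)] [MoeglinWaldspurger1995, I.2.12, I.4.10], on the `Z`-side and free of the reflected exponent:
`f₀ := ιψ − cnstN(ιψ) ∈ 𝓗_k(Z_a)^cusp` (★ `sub_cnstN_mem_HNcusp`); `hδι` gives `δ(ιψ) = λ•restr(ιψ)`, so a.e. on `Z_{a₀}` **`λ·ιψ = R(h)f₀ + b'·δ(α₂)`** (§1); K2's cusp-decay letter
`hK1` bounds `R(h)f₀` by `C‖f₀‖HZ^{−m}`, so `ιψ` is ESSENTIALLY BOUNDED on `Z_{a₀}` as soon as `δ(α₂)` is (§1; §2 PAYS that bound from `α₂ =ᵐ HZ^w`, `Re w ≤ 0`, by ★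
`rightConvFun_congr_ae_restrict`: `|∫ h(y)HZ(x·y)^w dy| ≤ a^{Re w}‖h‖₁`); hence `‖ψ ∘ p‖ ≤ M` a.e. on `{a₀ < HZ}` (★ `coeFn_iota`), and (§3, CM pair, `N = 2`) `ψ ∈ L²(μ)` by the ★
covering comparison of P2a-ι: LOWER at weight `0` on `Z_{c₀}`, the piece `{c₀ < HZ ≤ a₀}` by `a₀^{2k}·`UPPER at weight `k` (`ψ ∈ 𝓗_k(𝔛)`), the piece `{a₀ < HZ}` by `M²·μZ(Z_{a₀}) < ∞`.
THEOREMS ONLY (no `def`, no `instance`, no `notation`, no named-fact hypothesis, no `sorry`); lane `--kind proof --supports stmt-HodgeConjecture-24833 --as helper` (count-neutral).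

* §1 (rank `N`, generic measures) `coeFn_deltaShift_iota_of_apply_eq_smul`, `ae_eq_rightConvFun_add_of_homogeneous` (the displayed identity), **`ae_norm_iota_le_of_homogeneous`**
  (`‖ιψ x‖ ≤ |λ|⁻¹(C‖f₀‖HZ(x)^{−m} + |b'|·‖δ(α₂) x‖)` a.e. on `Z_{a₀}`, from `hK1` in ★ P8 §2's bytes), `exists_ae_norm_iota_le_of_homogeneous` (uniform bound), `ae_restrict_norm_comp_pZX_le`
  (`‖ψ(p x)‖ ≤ M` a.e. for `μZ|_{Z_{a₀}}`).
* §2 (rank `N`) **`exists_ae_norm_deltaShift_le_of_ae_eq_cpow`** — PAYMENT of the letter `hδα₂` from `α =ᵐ HZ^w` (`Re w ≤ 0`) and the right-shift data the `ShiftBound` discharge already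
  uses (`hright`, `Ω ⊇ supp h` measurable, `κ·a ≤ a₀`, `HZ(x) ≤ κ·HZ(x·y)` on `Ω`).
* §3 (CM pair, `N = 2`, ★ p858831 frame `(L μ νG hβ hμZ)`) **`memLp_two_of_ae_norm_comp_pZX_le_cm`**: `ψ ∈ 𝓗_k(𝔛)`, `‖ψ ∘ p‖ ≤ M` a.e. on `{a₀ < HZ}`, `μZ(Z_{a₀}) < ∞` ⟹ `ψ ∈ L²(μ)`.
* §4 THE HEADS, conclusions = the `hL2` slot of ★∕📤 P6′ §2 BYTE-FOR-BYTE (`ι := iota hb`, `P := cnstN k a μZ`): **`hL2_of_lt (σ₀ n i₀)`** (rank `N`, on the transfer letter `htr` = §3's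
  shape) and **`hL2_cm_two`** (CM pair, `N = 2`, `σ₀ = 1`, `htr` discharged by §3).  Remaining letters: `hK1` (K2, K2E1-p11), `hδι` (★ P3-C), `hδα₂` (§2 here, from ★ P8-β's `hα₂`).

HONEST LABEL.  Count-neutral helper of the BL-SPH-2 template (consumer: P8 proper's `hunq` through P6′ §2); closes no socket; HC_CM is proved only modulo the 7 printed citations (2
remaining named inputs: hLiu418 = `stmt-HodgeConjecture-24832`, h413 = `stmt-HodgeConjecture-24833`) until rung 0 closes.

## References
* [BernsteinLapid2019] J. Bernstein, E. Lapid, *On the meromorphic continuation of Eisenstein series*, J. Amer. Math. Soc. 37 (2024) (arXiv:1911.02342), §4 Claims 2, 4, 5 (pp. 9–10).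
* [MoeglinWaldspurger1995] C. Mœglin, J.-L. Waldspurger, *Spectral Decomposition and Eisenstein Series* (1995), I.2.12–I.2.13, I.4.10.
* [Borel1963] A. Borel, *Some finiteness properties of adele groups over number fields*, Publ. IHÉS 16 (1963), §5 (Siegel sets cover, finitely many overlaps).
* [Folland1999] G. B. Folland, *Real Analysis*, 2nd ed. (1999), Thm. 2.37 (Tonelli), Prop. 2.23.
-/

set_option autoImplicit false
-- the mandated namespace repeats `HodgeConjecture.HodgeConjecture`, as in every `Theorems/*.lean` of this sub-problem
set_option linter.dupNamespace false

noncomputable section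

open MeasureTheory MeasureTheory.Measure Set NumberField IsDedekindDomain Filter Topology Metric
open scoped NNReal ENNReal
open Literature.MeasureTheory.Group Literature.NumberTheory.Automorphic Literature.NumberTheory.Automorphic.UnitaryGroup AdelicGroupData
open Summit.HodgeConjecture.HodgeConjecture.Cruxes.H413.K2E1BLBorelSpacesU2Defs
open Summit.HodgeConjecture.HodgeConjecture.Cruxes.H413.K2E1BLBorelOperatorsU2Defs
open Summit.HodgeConjecture.HodgeConjecture.Cruxes.H413.K2E1BLSpacesU2 (coeFn_restrHN sub_cnstN_mem_HNcusp)
open Summit.HodgeConjecture.HodgeConjecture.Cruxes.H413.K2E1BLShiftBoundU2 (ae_weightedTruncMeasure_iff lintegral_weightedTruncMeasure)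
open Summit.HodgeConjecture.HodgeConjecture.Cruxes.H413.K2E1BLRightConvTonelliU2 (rightConvFun_congr_ae_restrict borelQuotHeight_pos)
open Summit.HodgeConjecture.HodgeConjecture.Cruxes.H413.K2E1TruncatedCuspCompactU2 (ae_lt_borelQuotHeight_weightedTruncMeasure measurableSet_lt_borelQuotHeight)
open Summit.HodgeConjecture.HodgeConjecture.Cruxes.H413.K2E1BLIotaUnfoldingU (measurable_pZX)
open Summit.HodgeConjecture.HodgeConjecture.Cruxes.H413.K2E1BLIotaBoundU2

namespace Summit.HodgeConjecture.HodgeConjecture.Cruxes.H413.K2E1BLHomogeneousL2U2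

/-! ## §1 The a.e. algebra on `Z_{a₀}`: `λ·ιψ = R(h)f₀ + b'·δ(α₂)`, and the essential bound on `ιψ` -/

section Generic

variable {F E : Type} [Field F] [NumberField F] [Field E] [NumberField E] [Algebra F E] {c : E ≃ₐ[F] E} {N : ℕ} [NeZero N]
  [MeasurableSpace (quasiSplit F E c N).Adelic]
  {k : ℕ} {a a₀ : ℝ≥0} {μ : Measure (quasiSplit F E c N).automorphicQuotient} {μZ : Measure (borelQuotient F E c N)}
  {νG : Measure (quasiSplit F E c N).Adelic} {h : (quasiSplit F E c N).Adelic → ℂ}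

/-- **`δ(ιψ) = λ·ιψ` a.e. on `Z_{a₀}`** for an eigenvector `T ψ = λ•ψ` of the `𝔛`-side operator intertwined by `hδι : δ ∘ ι = restr ∘ ι ∘ T` (★ P3-C `deltaShift_comp_iota`): as vectors
`δ(ιψ) = λ • restr(ιψ)`, and `restr` does not change a.e. values (★ `coeFn_restrHN`). [cite: BernsteinLapid2019, §4 Claim 2 (p. 9)] -/
theorem coeFn_deltaShift_iota_of_apply_eq_smul (haa₀ : a ≤ a₀) (hb : IotaBound F E c N k a μ μZ) (hs : ShiftBound F E c N k a a₀ νG μZ h)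
    {T : HX F E c N k μ →L[ℂ] HX F E c N k μ} (hδι : deltaShift hs ∘L iota hb = restrHN F E c N k haa₀ μZ ∘L iota hb ∘L T)
    {ψ : HX F E c N k μ} {lam : ℂ} (hTψ : T ψ = lam • ψ) :
    (deltaShift hs (iota hb ψ) : borelQuotient F E c N → ℂ) =ᵐ[weightedTruncMeasure F E c N k a₀ μZ]
      fun x => lam * (iota hb ψ : borelQuotient F E c N → ℂ) x := by
  have h1 : deltaShift hs (iota hb ψ) = lam • restrHN F E c N k haa₀ μZ (iota hb ψ) := by
    have h0 := congrArg (fun S : HX F E c N k μ →L[ℂ] HN F E c N k a₀ μZ => S ψ) hδι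
    simpa only [ContinuousLinearMap.comp_apply, hTψ, map_smul] using h0
  rw [h1]
  filter_upwards [Lp.coeFn_smul lam (restrHN F E c N k haa₀ μZ (iota hb ψ)), coeFn_restrHN haa₀ (iota hb ψ)] with x hx hx'
  rw [hx, Pi.smul_apply, hx', smul_eq_mul]

/-- **THE IDENTITY `λ·ιψ = R(h)f₀ + b'·δ(α₂)` a.e. on `Z_{a₀}`**, `f₀ = ιψ − cnstN(ιψ)`, for a homogeneous solution (`T ψ = λ•ψ`, `cnstN(ιψ) = b'•α`): linearity of `δ` and ★
`deltaShift_spec` (`δ f =ᵐ R(h) f`). [cite: BernsteinLapid2019, §4 Claim 2 (p. 9) and Claim 5 (p. 10)] -/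
theorem ae_eq_rightConvFun_add_of_homogeneous (haa₀ : a ≤ a₀) (hb : IotaBound F E c N k a μ μZ) (hs : ShiftBound F E c N k a a₀ νG μZ h)
    {T : HX F E c N k μ →L[ℂ] HX F E c N k μ} (hδι : deltaShift hs ∘L iota hb = restrHN F E c N k haa₀ μZ ∘L iota hb ∘L T)
    {ψ : HX F E c N k μ} {lam : ℂ} (hTψ : T ψ = lam • ψ) {α : HN F E c N k a μZ} {b' : ℂ} (hP : cnstN F E c N k a μZ (iota hb ψ) = b' • α) :
    (fun x => lam * (iota hb ψ : borelQuotient F E c N → ℂ) x) =ᵐ[weightedTruncMeasure F E c N k a₀ μZ]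
      fun x => rightConvFun F E c N νG h ((iota hb ψ - cnstN F E c N k a μZ (iota hb ψ) : HN F E c N k a μZ) : borelQuotient F E c N → ℂ) x
        + b' * (deltaShift hs α : borelQuotient F E c N → ℂ) x := by
  have h1 : deltaShift hs (iota hb ψ - cnstN F E c N k a μZ (iota hb ψ)) = deltaShift hs (iota hb ψ) - b' • deltaShift hs α := by
    rw [map_sub, hP, map_smul]
  filter_upwards [coeFn_deltaShift_iota_of_apply_eq_smul haa₀ hb hs hδι hTψ, deltaShift_spec hs (iota hb ψ - cnstN F E c N k a μZ (iota hb ψ)),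
    Lp.coeFn_sub (deltaShift hs (iota hb ψ)) (b' • deltaShift hs α), Lp.coeFn_smul b' (deltaShift hs α)] with x hx h2 h3 h4
  rw [h1, h3, Pi.sub_apply, h4, Pi.smul_apply, smul_eq_mul, hx] at h2
  rw [← h2]; ring

/-- **THE ESSENTIAL BOUND ON `ιψ`** (the heart of item (i)): with K2's cusp-decay letter `hK1` (★ P8 §2's bytes: `‖R(h)f‖ ≤ C‖f‖HZ^{−m}` a.e. on `Z_{a₀}` for `f ∈ 𝓗_k(Z_a)^cusp`) applied to
`f₀ = ιψ − cnstN(ιψ)` (★ `sub_cnstN_mem_HNcusp`) and `λ ≠ 0`: a.e. on `Z_{a₀}`, `‖ιψ(x)‖ ≤ |λ|⁻¹·(C‖f₀‖·HZ(x)^{−m} + |b'|·‖δ(α₂)(x)‖)`.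
[cite: BernsteinLapid2019, §4 Claim 2 (p. 9) and Claim 5 (p. 10)] [cite: MoeglinWaldspurger1995, I.2.12] -/
theorem ae_norm_iota_le_of_homogeneous (haa₀ : a ≤ a₀) (hb : IotaBound F E c N k a μ μZ) (hs : ShiftBound F E c N k a a₀ νG μZ h)
    {T : HX F E c N k μ →L[ℂ] HX F E c N k μ} (hδι : deltaShift hs ∘L iota hb = restrHN F E c N k haa₀ μZ ∘L iota hb ∘L T)
    {ψ : HX F E c N k μ} {lam : ℂ} (hTψ : T ψ = lam • ψ) (hlam : lam ≠ 0) {α : HN F E c N k a μZ} {b' : ℂ} (hP : cnstN F E c N k a μZ (iota hb ψ) = b' • α)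
    {C m : ℝ} (hK1 : ∀ f : HNcusp F E c N k a μZ, ∀ᵐ x ∂(weightedTruncMeasure F E c N k a₀ μZ),
      ‖rightConvFun F E c N νG h ((f : HN F E c N k a μZ) : borelQuotient F E c N → ℂ) x‖ ≤ C * ‖f‖ * ((borelQuotHeight F E c N x : ℝ)) ^ (-m)) :
    ∀ᵐ x ∂(weightedTruncMeasure F E c N k a₀ μZ), ‖(iota hb ψ : borelQuotient F E c N → ℂ) x‖ ≤
      ‖lam‖⁻¹ * (C * ‖iota hb ψ - cnstN F E c N k a μZ (iota hb ψ)‖ * ((borelQuotHeight F E c N x : ℝ)) ^ (-m)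
        + ‖b'‖ * ‖(deltaShift hs α : borelQuotient F E c N → ℂ) x‖) := by
  have hf₀ := hK1 ⟨iota hb ψ - cnstN F E c N k a μZ (iota hb ψ), sub_cnstN_mem_HNcusp (iota hb ψ)⟩
  have hpos : 0 < ‖lam‖ := norm_pos_iff.2 hlam
  filter_upwards [ae_eq_rightConvFun_add_of_homogeneous haa₀ hb hs hδι hTψ hP, hf₀] with x hx hKx
  rw [le_inv_mul_iff₀ hpos, ← norm_mul, hx]
  exact (norm_add_le _ _).trans (add_le_add hKx (le_of_eq (norm_mul _ _)))

/-- **UNIFORM ESSENTIAL BOUND**: if moreover `C, m ≥ 0`, `a₀ > 0` and `δ(α₂)` is essentially bounded on `Z_{a₀}` (letter `hδα`, §2), then `‖ιψ‖ ≤ M` a.e. on `Z_{a₀}` (`HZ > a₀` a.e., ★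
`ae_lt_borelQuotHeight_weightedTruncMeasure`, so `HZ^{−m} ≤ a₀^{−m}`). [cite: BernsteinLapid2019, §4 Claim 2 (p. 9)] -/
theorem exists_ae_norm_iota_le_of_homogeneous (ha₀ : 0 < a₀) (haa₀ : a ≤ a₀) (hb : IotaBound F E c N k a μ μZ) (hs : ShiftBound F E c N k a a₀ νG μZ h)
    {T : HX F E c N k μ →L[ℂ] HX F E c N k μ} (hδι : deltaShift hs ∘L iota hb = restrHN F E c N k haa₀ μZ ∘L iota hb ∘L T)
    {ψ : HX F E c N k μ} {lam : ℂ} (hTψ : T ψ = lam • ψ) (hlam : lam ≠ 0) {α : HN F E c N k a μZ} {b' : ℂ} (hP : cnstN F E c N k a μZ (iota hb ψ) = b' • α)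
    {C m : ℝ} (hC : 0 ≤ C) (hm : 0 ≤ m) (hK1 : ∀ f : HNcusp F E c N k a μZ, ∀ᵐ x ∂(weightedTruncMeasure F E c N k a₀ μZ),
      ‖rightConvFun F E c N νG h ((f : HN F E c N k a μZ) : borelQuotient F E c N → ℂ) x‖ ≤ C * ‖f‖ * ((borelQuotHeight F E c N x : ℝ)) ^ (-m))
    {M₁ : ℝ} (hδα : ∀ᵐ x ∂(weightedTruncMeasure F E c N k a₀ μZ), ‖(deltaShift hs α : borelQuotient F E c N → ℂ) x‖ ≤ M₁) :
    ∃ M : ℝ, ∀ᵐ x ∂(weightedTruncMeasure F E c N k a₀ μZ), ‖(iota hb ψ : borelQuotient F E c N → ℂ) x‖ ≤ M := by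
  refine ⟨‖lam‖⁻¹ * (C * ‖iota hb ψ - cnstN F E c N k a μZ (iota hb ψ)‖ * ((a₀ : ℝ)) ^ (-m) + ‖b'‖ * M₁), ?_⟩
  filter_upwards [ae_norm_iota_le_of_homogeneous haa₀ hb hs hδι hTψ hlam hP hK1, hδα, ae_lt_borelQuotHeight_weightedTruncMeasure k a₀ μZ] with x hx hδx hHx
  refine hx.trans (mul_le_mul_of_nonneg_left (add_le_add ?_ ?_) (inv_nonneg.2 (norm_nonneg _)))
  · exact mul_le_mul_of_nonneg_left (Real.rpow_le_rpow_of_nonpos (NNReal.coe_pos.2 ha₀) (NNReal.coe_le_coe.2 hHx.le) (neg_nonpos.2 hm))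
      (mul_nonneg hC (norm_nonneg _))
  · exact mul_le_mul_of_nonneg_left hδx (norm_nonneg _)

omit [MeasurableSpace (quasiSplit F E c N).Adelic] in
/-- **FROM `ιψ` TO `ψ ∘ p`**: an essential bound for `ιψ` on `Z_{a₀}` is an essential bound for `ψ ∘ p` for `μZ|_{Z_{a₀}}` (★ `coeFn_iota`: `ιψ =ᵐ ψ ∘ p`; the weight `HZ^{−2k}` never vanishes,
★ `ae_weightedTruncMeasure_iff`). [cite: BernsteinLapid2019, §4 Claim 4 (p. 10)] -/
theorem ae_restrict_norm_comp_pZX_le (haa₀ : a ≤ a₀) (hb : IotaBound F E c N k a μ μZ) {ψ : HX F E c N k μ} {M : ℝ}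
    (hM : ∀ᵐ x ∂(weightedTruncMeasure F E c N k a₀ μZ), ‖(iota hb ψ : borelQuotient F E c N → ℂ) x‖ ≤ M) :
    ∀ᵐ x ∂(μZ.restrict {x | a₀ < borelQuotHeight F E c N x}), ‖(ψ : (quasiSplit F E c N).automorphicQuotient → ℂ) (pZX F E c N x)‖ ≤ M := by
  rw [← ae_weightedTruncMeasure_iff μZ k a₀]
  filter_upwards [hM, (weightedTruncMeasure_absolutelyContinuous F E c N k haa₀ μZ).ae_le (coeFn_iota hb ψ)] with x hx hx'
  rw [hx'] at hx
  exact hx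

/-! ## §2 PAYMENT of the letter `hδα₂`: `δ(α)` is essentially bounded on `Z_{a₀}` when `α =ᵐ HZ^w`, `Re w ≤ 0` -/

section Payment

variable [BorelSpace (quasiSplit F E c N).Adelic]

/-- **`δ(α)` IS ESSENTIALLY BOUNDED ON `Z_{a₀}`** for `α =ᵐ HZ^w` on `Z_a` with `Re w ≤ 0`: `δ(α) =ᵐ R(h)α` (★ `deltaShift_spec`) `=ᵐ R(h)(HZ^w)` (★ `rightConvFun_congr_ae_restrict`, with the
right-shift data `hright`, `Ω ⊇ supp h`, `κ·a ≤ a₀`, `HZ(x) ≤ κ·HZ(x·y)` of the `ShiftBound` discharge), and for `x ∈ Z_{a₀}`, `y ∈ Ω` one has `HZ(x·y) > a`, so `|HZ(x·y)^w| ≤ a^{Re w}`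
and `|R(h)(HZ^w)(x)| ≤ a^{Re w}·‖h‖₁`.  (At `N = 2` `w = 1 − z`, at `N = 3` `w = 2 − z`: `Re w < 0` on the Godement set.) [cite: BernsteinLapid2019, §4 p. 10] [cite: Folland1999, Thm. 2.37] -/
theorem exists_ae_norm_deltaShift_le_of_ae_eq_cpow [SFinite νG] [SFinite μZ] (hright : ∀ y, MeasurePreserving (rightShift F E c N y) μZ μZ)
    {Ω : Set (quasiSplit F E c N).Adelic} (hΩm : MeasurableSet Ω) {κ : ℝ≥0} (hκ : 0 < κ) (hc : κ * a ≤ a₀)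
    (hΩ : ∀ z : borelQuotient F E c N, ∀ y ∈ Ω, borelQuotHeight F E c N z ≤ κ * borelQuotHeight F E c N (rightShift F E c N y z))
    (hsupp : ∀ y, y ∉ Ω → h y = 0) (hh : Integrable h νG) (hs : ShiftBound F E c N k a a₀ νG μZ h) (ha : 0 < a)
    {α : HN F E c N k a μZ} {w : ℂ}
    (hα : (α : borelQuotient F E c N → ℂ) =ᵐ[weightedTruncMeasure F E c N k a μZ] fun x => (((borelQuotHeight F E c N x : ℝ≥0) : ℝ) : ℂ) ^ w) (hw : w.re ≤ 0) :
    ∃ M : ℝ, ∀ᵐ x ∂(weightedTruncMeasure F E c N k a₀ μZ), ‖(deltaShift hs α : borelQuotient F E c N → ℂ) x‖ ≤ M := by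
  refine ⟨((a : ℝ)) ^ w.re * ∫ y, ‖h y‖ ∂νG, ?_⟩
  have hα' : (α : borelQuotient F E c N → ℂ) =ᵐ[μZ.restrict {z | a < borelQuotHeight F E c N z}]
      fun x => (((borelQuotHeight F E c N x : ℝ≥0) : ℝ) : ℂ) ^ w := (ae_weightedTruncMeasure_iff μZ k a).1 hα
  have hR := rightConvFun_congr_ae_restrict νG μZ hright hΩm hκ hc hΩ hsupp hα'
  rw [ae_weightedTruncMeasure_iff μZ k a₀]
  filter_upwards [(ae_weightedTruncMeasure_iff μZ k a₀).1 (deltaShift_spec hs α), hR, ae_restrict_mem (measurableSet_lt_borelQuotHeight a₀)] with x hδx hRx hx₀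
  rw [hδx, hRx]
  have hx₀' : a₀ < borelQuotHeight F E c N x := hx₀
  have hbound : ∀ y, ‖h y * (((borelQuotHeight F E c N (rightShift F E c N y x) : ℝ≥0) : ℝ) : ℂ) ^ w‖ ≤ ((a : ℝ)) ^ w.re * ‖h y‖ := by
    intro y
    by_cases hy : y ∈ Ω
    · have haH : a < borelQuotHeight F E c N (rightShift F E c N y x) := lt_of_mul_lt_mul_left ((hc.trans_lt hx₀').trans_le (hΩ x y hy)) hκ.le
      rw [norm_mul, Complex.norm_cpow_eq_rpow_re_of_pos (NNReal.coe_pos.2 (borelQuotHeight_pos _)), mul_comm]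
      exact mul_le_mul_of_nonneg_right (Real.rpow_le_rpow_of_nonpos (NNReal.coe_pos.2 ha) (NNReal.coe_le_coe.2 haH.le) hw) (norm_nonneg _)
    · simp only [hsupp y hy, zero_mul, norm_zero, mul_zero, le_refl]
  calc ‖rightConvFun F E c N νG h (fun x => (((borelQuotHeight F E c N x : ℝ≥0) : ℝ) : ℂ) ^ w) x‖
      ≤ ∫ y, ((a : ℝ)) ^ w.re * ‖h y‖ ∂νG := norm_integral_le_of_norm_le (hh.norm.const_mul _) (Eventually.of_forall hbound)
    _ = ((a : ℝ)) ^ w.re * ∫ y, ‖h y‖ ∂νG := integral_const_mul _ _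

end Payment

/-! ## §4a THE RANK-GENERIC HEAD: the letter `hL2` of P6′ §2 `hunq_of_memLp_of_lt`, on the transfer letter `htr` -/

/-- **ITEM (i), RANK-GENERIC: A HOMOGENEOUS SOLUTION AT A POINT OF `U₀` IS IN `L²(μ)`** — the `hL2` slot of ★∕📤 P6′ §2 `hunq_of_memLp_of_lt` BYTE-FOR-BYTE with `ι := iota hb`,
`P := cnstN k a μZ`.  Data: `σ₀`, `n`, ONE index `i₀` with the levels `a ≤ a₀` (`a₀ > 0`), the ι-package letter `hb`, `ShiftBound` for `h i₀`, the `𝔛`-side operators `T i` with P3-C's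
intertwining for `i₀` (★ `deltaShift_comp_iota`), K2's cusp-decay letter `hK1` for `h i₀` (★ P8 §2's bytes, `C, m ≥ 0`), the constant-term vector `α₂` with the essential bound `hδα₂` of
`δ(α₂ z)` on `Z_{a₀}` (§2 pays it), and the transfer letter `htr` («`ψ ∈ 𝓗_k(𝔛)` with `ψ ∘ p` essentially bounded on `{a₀ < HZ}` is in `L²(μ)`», §3 pays it for the CM pair at `N = 2`).
THEN for `z ∈ ball 0 (n+2)`, `σ₀ < Re z`, `Im ĥ_{i₀}(z) ≠ 0` (so `λ = ĥ_{i₀}(z) ≠ 0`), every `ψ` with `T i ψ = ĥ_i(z)•ψ` (all `i`), `cnstN(ιψ) = b'•α₂ z` (and `Q ψ = 0`, unused) is in `L²(μ)`.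
[cite: BernsteinLapid2019, §4 Claim 2 (p. 9), Claim 5 (p. 10)] [cite: MoeglinWaldspurger1995, I.4.10] -/
theorem hL2_of_lt (σ₀ : ℝ) (n : ℕ) {I : Type*} (i₀ : I) {hI : I → (quasiSplit F E c N).Adelic → ℂ}
    (ha₀ : 0 < a₀) (haa₀ : a ≤ a₀) (hb : IotaBound F E c N k a μ μZ) (hs : ShiftBound F E c N k a a₀ νG μZ (hI i₀))
    (T : I → HX F E c N k μ →L[ℂ] HX F E c N k μ) (hδι : deltaShift hs ∘L iota hb = restrHN F E c N k haa₀ μZ ∘L iota hb ∘L T i₀)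
    {C m : ℝ} (hC : 0 ≤ C) (hm : 0 ≤ m)
    (hK1 : ∀ f : HNcusp F E c N k a μZ, ∀ᵐ x ∂(weightedTruncMeasure F E c N k a₀ μZ),
      ‖rightConvFun F E c N νG (hI i₀) ((f : HN F E c N k a μZ) : borelQuotient F E c N → ℂ) x‖ ≤ C * ‖f‖ * ((borelQuotHeight F E c N x : ℝ)) ^ (-m))
    (α₂ : ℂ → HN F E c N k a μZ)
    (hδα₂ : ∀ z ∈ ball (0 : ℂ) (n + 2), σ₀ < z.re →
      ∃ M : ℝ, ∀ᵐ x ∂(weightedTruncMeasure F E c N k a₀ μZ), ‖(deltaShift hs (α₂ z) : borelQuotient F E c N → ℂ) x‖ ≤ M)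
    (htr : ∀ (ψ : HX F E c N k μ) (M : ℝ), (∀ᵐ x ∂(μZ.restrict {x | a₀ < borelQuotHeight F E c N x}),
      ‖(ψ : (quasiSplit F E c N).automorphicQuotient → ℂ) (pZX F E c N x)‖ ≤ M) → MemLp (ψ : (quasiSplit F E c N).automorphicQuotient → ℂ) 2 μ)
    {X' : Type*} [NormedAddCommGroup X'] [NormedSpace ℂ X'] (Q : HX F E c N k μ →L[ℂ] X') :
    ∀ z ∈ ball (0 : ℂ) (n + 2), σ₀ < z.re → (∫ x, hI i₀ x * (((borelHeight x : ℝ≥0) : ℝ) : ℂ) ^ z ∂νG).im ≠ 0 →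
      ∀ (ψ : HX F E c N k μ) (b' : ℂ), (∀ i, T i ψ = (∫ x, hI i x * (((borelHeight x : ℝ≥0) : ℝ) : ℂ) ^ z ∂νG) • ψ) →
        cnstN F E c N k a μZ (iota hb ψ) = b' • α₂ z → Q ψ = 0 → MemLp (ψ : (quasiSplit F E c N).automorphicQuotient → ℂ) 2 μ := by
  intro z hzb hzσ hzim ψ b' hTψ hP _
  obtain ⟨M₁, hM₁⟩ := hδα₂ z hzb hzσ
  have hlam : (∫ x, hI i₀ x * (((borelHeight x : ℝ≥0) : ℝ) : ℂ) ^ z ∂νG) ≠ 0 := fun h0 => hzim (by rw [h0, Complex.zero_im])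
  obtain ⟨M, hM⟩ := exists_ae_norm_iota_le_of_homogeneous ha₀ haa₀ hb hs hδι (hTψ i₀) hlam hP hC hm hK1 hM₁
  exact htr ψ M (ae_restrict_norm_comp_pZX_le haa₀ hb hM)

end Generic

/-! ## §3 (CM pair, `N = 2`) The transfer: `ψ ∈ 𝓗_k(𝔛)` with `ψ ∘ p` essentially bounded high in the cusp is in `L²(μ)` -/

section CM

variable (L : Type) [Field L] [NumberField L] [IsCMField L]
  [MeasurableSpace (quasiSplit (↥(maximalRealSubfield L)) L (IsCMField.complexConj L) 2).Adelic]
  [BorelSpace (quasiSplit (↥(maximalRealSubfield L)) L (IsCMField.complexConj L) 2).Adelic]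

/-- **THE TRANSFER `Z → 𝔛` AT WEIGHT `0`** (CM pair, `N = 2`): if `ψ ∈ 𝓗_k(𝔛)` and `‖ψ ∘ p‖ ≤ M` a.e. on `{a₀ < HZ}` with `μZ{a₀ < HZ} < ∞`, then `ψ ∈ L²(𝔛, μ)`.  ★ LOWER comparison of
P2a-ι (p858831, weight `0`, level `c₀ := min(c₁∕2, a₀)`): `A·∫_𝔛 |ψ|² dμ ≤ ∫_{Z_{c₀}} |ψ∘p|² dμZ`; on `{c₀ < HZ ≤ a₀}`, `|ψ∘p|² ≤ a₀^{2k}·HZ^{−2k}|ψ∘p|²`, integrated `≤ a₀^{2k}·B·‖ψ‖²_{𝓗_k(𝔛)}`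
(★ UPPER comparison at weight `k`); on `{a₀ < HZ}`, `≤ M²·μZ{a₀ < HZ}`. [cite: BernsteinLapid2019, §4 Claim 4 (p. 10)] [cite: Borel1963, §5] [cite: MoeglinWaldspurger1995, I.2.13] -/
theorem memLp_two_of_ae_norm_comp_pZX_le_cm
    (μ : Measure (quasiSplit (↥(maximalRealSubfield L)) L (IsCMField.complexConj L) 2).automorphicQuotient)
    [(quasiSplit (↥(maximalRealSubfield L)) L (IsCMField.complexConj L) 2).IsAutomorphicMeasure μ]
    (νG : Measure (quasiSplit (↥(maximalRealSubfield L)) L (IsCMField.complexConj L) 2).Adelic) [νG.IsHaarMeasure] [νG.IsInvInvariant]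
    {β : (quasiSplit (↥(maximalRealSubfield L)) L (IsCMField.complexConj L) 2).Adelic → ℝ≥0∞}
    (hβ : IsCoveringWeight ↥((arithmeticBorel (↥(maximalRealSubfield L)) L (IsCMField.complexConj L) 2).map
      (quasiSplit (↥(maximalRealSubfield L)) L (IsCMField.complexConj L) 2).arithmeticSubgroup.subtype) β)
    {μZ : Measure (borelQuotient (↥(maximalRealSubfield L)) L (IsCMField.complexConj L) 2)}
    (hμZ : ∀ f : borelQuotient (↥(maximalRealSubfield L)) L (IsCMField.complexConj L) 2 → ℝ≥0∞, Measurable f →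
      ∫⁻ z, f z ∂μZ = ∫⁻ g, β g * f (toBorelQuotient (↥(maximalRealSubfield L)) L (IsCMField.complexConj L) 2 g) ∂νG)
    (k : ℕ) (ψ : HX (↥(maximalRealSubfield L)) L (IsCMField.complexConj L) 2 k μ) {a₀ : ℝ≥0} (ha₀ : 0 < a₀)
    (hfin : μZ {x | a₀ < borelQuotHeight (↥(maximalRealSubfield L)) L (IsCMField.complexConj L) 2 x} ≠ ∞) {M : ℝ}
    (hM : ∀ᵐ x ∂(μZ.restrict {x | a₀ < borelQuotHeight (↥(maximalRealSubfield L)) L (IsCMField.complexConj L) 2 x}),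
      ‖(ψ : (quasiSplit (↥(maximalRealSubfield L)) L (IsCMField.complexConj L) 2).automorphicQuotient → ℂ)
        (pZX (↥(maximalRealSubfield L)) L (IsCMField.complexConj L) 2 x)‖ ≤ M) :
    MemLp (ψ : (quasiSplit (↥(maximalRealSubfield L)) L (IsCMField.complexConj L) 2).automorphicQuotient → ℂ) 2 μ := by
  -- the two comparison constants and the level `c₀`
  obtain ⟨c₁, hc₁, hlow⟩ := exists_pos_forall_mul_lintegral_le_lintegral_comp_pZX_cm L μ νG hβ hμZ 0
  set c₀ : ℝ≥0 := min (c₁ / 2) a₀ with hc₀def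
  have hc₀pos : 0 < c₀ := lt_min (half_pos hc₁) ha₀
  have hc₀lt : c₀ < c₁ := lt_of_le_of_lt (min_le_left _ _) (half_lt_self hc₁)
  obtain ⟨A, hA0, -, hA⟩ := hlow c₀ hc₀pos hc₀lt
  obtain ⟨B, hBt, hB⟩ := exists_forall_lintegral_comp_pZX_le_cm L μ νG hβ hμZ hc₀pos k
  -- the function `Φ = |ψ|²` and the weights
  have hψm : Measurable (ψ : (quasiSplit (↥(maximalRealSubfield L)) L (IsCMField.complexConj L) 2).automorphicQuotient → ℂ) := (Lp.stronglyMeasurable ψ).measurable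
  set Φ : (quasiSplit (↥(maximalRealSubfield L)) L (IsCMField.complexConj L) 2).automorphicQuotient → ℝ≥0∞ :=
    fun x => ‖(ψ : _ → ℂ) x‖ₑ ^ (2 : ℝ) with hΦ
  have hΦm : Measurable Φ := hψm.enorm.pow_const _
  -- `ψ ∈ 𝓗_k(𝔛)`: the weighted integral is finite
  have hwm := measurable_supHeight_inv_pow (F := ↥(maximalRealSubfield L)) (E := L) (c := IsCMField.complexConj L) k
  have hXfin : ∫⁻ x, Φ x * (((supHeight (↥(maximalRealSubfield L)) L (IsCMField.complexConj L) 2 x)⁻¹ ^ (2 * k) : ℝ≥0) : ℝ≥0∞) ∂μ < ∞ := by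
    have h2 := Lp.eLpNorm_lt_top ψ
    rw [eLpNorm_eq_lintegral_rpow_enorm_toReal two_ne_zero ENNReal.ofNat_ne_top, ENNReal.toReal_ofNat,
      ENNReal.rpow_lt_top_iff_of_pos (by norm_num : (0 : ℝ) < 1 / 2), lintegral_withDensity_eq_lintegral_mul _ hwm hΦm] at h2
    refine lt_of_le_of_lt (le_of_eq (lintegral_congr fun x => ?_)) h2
    exact mul_comm _ _
  -- LOWER comparison at weight `0`
  have hlow0 : A * ∫⁻ x, Φ x ∂μ ≤ ∫⁻ z, Φ (pZX (↥(maximalRealSubfield L)) L (IsCMField.complexConj L) 2 z)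
      ∂(weightedTruncMeasure (↥(maximalRealSubfield L)) L (IsCMField.complexConj L) 2 0 c₀ μZ) := by
    have h0 := hA Φ hΦm
    simpa only [Nat.mul_zero, pow_zero, ENNReal.coe_one, mul_one] using h0
  have hw0 : weightedTruncMeasure (↥(maximalRealSubfield L)) L (IsCMField.complexConj L) 2 0 c₀ μZ =
      μZ.restrict {z | c₀ < borelQuotHeight (↥(maximalRealSubfield L)) L (IsCMField.complexConj L) 2 z} := by
    show (μZ.restrict _).withDensity _ = _
    rw [show (fun z : borelQuotient (↥(maximalRealSubfield L)) L (IsCMField.complexConj L) 2 =>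
        ((((borelQuotHeight (↥(maximalRealSubfield L)) L (IsCMField.complexConj L) 2 z)⁻¹ ^ (2 * 0) : ℝ≥0)) : ℝ≥0∞)) = (1 : borelQuotient (↥(maximalRealSubfield L)) L (IsCMField.complexConj L) 2 → ℝ≥0∞) from
      funext fun z => by rw [Nat.mul_zero, pow_zero, ENNReal.coe_one, Pi.one_apply], withDensity_one]
  -- the pointwise splitting on `Z_{c₀}`
  have hM' : ∀ᵐ z ∂(μZ.restrict {z | c₀ < borelQuotHeight (↥(maximalRealSubfield L)) L (IsCMField.complexConj L) 2 z}),
      z ∈ {z | a₀ < borelQuotHeight (↥(maximalRealSubfield L)) L (IsCMField.complexConj L) 2 z} →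
        ‖(ψ : _ → ℂ) (pZX (↥(maximalRealSubfield L)) L (IsCMField.complexConj L) 2 z)‖ ≤ M :=
    ae_restrict_of_ae ((ae_restrict_iff' (measurableSet_lt_borelQuotHeight a₀)).1 hM)
  have hsplit : ∀ᵐ z ∂(μZ.restrict {z | c₀ < borelQuotHeight (↥(maximalRealSubfield L)) L (IsCMField.complexConj L) 2 z}),
      Φ (pZX (↥(maximalRealSubfield L)) L (IsCMField.complexConj L) 2 z) ≤
        ((a₀ ^ (2 * k) : ℝ≥0) : ℝ≥0∞) * (((((borelQuotHeight (↥(maximalRealSubfield L)) L (IsCMField.complexConj L) 2 z)⁻¹ ^ (2 * k) : ℝ≥0)) : ℝ≥0∞) * Φ (pZX (↥(maximalRealSubfield L)) L (IsCMField.complexConj L) 2 z))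
          + {z | a₀ < borelQuotHeight (↥(maximalRealSubfield L)) L (IsCMField.complexConj L) 2 z}.indicator (fun _ => ENNReal.ofReal M ^ (2 : ℝ)) z := by
    filter_upwards [hM'] with z hz
    by_cases hza : a₀ < borelQuotHeight (↥(maximalRealSubfield L)) L (IsCMField.complexConj L) 2 z
    · rw [Set.indicator_of_mem (show z ∈ {z | a₀ < borelQuotHeight (↥(maximalRealSubfield L)) L (IsCMField.complexConj L) 2 z} from hza)]
      refine le_add_left (ENNReal.rpow_le_rpow ?_ (by norm_num))
      rw [← ofReal_norm]
      exact ENNReal.ofReal_le_ofReal (hz hza)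
    · rw [Set.indicator_of_notMem (show z ∉ {z | a₀ < borelQuotHeight (↥(maximalRealSubfield L)) L (IsCMField.complexConj L) 2 z} from hza), add_zero, ← mul_assoc]
      have h1 : (1 : ℝ≥0∞) ≤ ((a₀ ^ (2 * k) : ℝ≥0) : ℝ≥0∞) * ((((borelQuotHeight (↥(maximalRealSubfield L)) L (IsCMField.complexConj L) 2 z)⁻¹ ^ (2 * k) : ℝ≥0)) : ℝ≥0∞) := by
        rw [← ENNReal.coe_mul, ← mul_pow, ENNReal.one_le_coe_iff]
        exact one_le_pow₀ ((le_mul_inv_iff₀ (borelQuotHeight_pos z)).2 (by rw [one_mul]; exact not_lt.1 hza))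
      calc Φ (pZX (↥(maximalRealSubfield L)) L (IsCMField.complexConj L) 2 z) = 1 * Φ (pZX (↥(maximalRealSubfield L)) L (IsCMField.complexConj L) 2 z) := (one_mul _).symm
        _ ≤ _ := mul_le_mul_of_nonneg_right h1 zero_le
  -- integrate the splitting
  have hint : ∫⁻ z, Φ (pZX (↥(maximalRealSubfield L)) L (IsCMField.complexConj L) 2 z)
      ∂(weightedTruncMeasure (↥(maximalRealSubfield L)) L (IsCMField.complexConj L) 2 0 c₀ μZ) ≤
        ((a₀ ^ (2 * k) : ℝ≥0) : ℝ≥0∞) * (B * ∫⁻ x, Φ x * (((supHeight (↥(maximalRealSubfield L)) L (IsCMField.complexConj L) 2 x)⁻¹ ^ (2 * k) : ℝ≥0) : ℝ≥0∞) ∂μ)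
          + ENNReal.ofReal M ^ (2 : ℝ) * μZ {z | a₀ < borelQuotHeight (↥(maximalRealSubfield L)) L (IsCMField.complexConj L) 2 z} := by
    rw [hw0]
    refine (lintegral_mono_ae hsplit).trans ?_
    have hwk : ∫⁻ z in {z | c₀ < borelQuotHeight (↥(maximalRealSubfield L)) L (IsCMField.complexConj L) 2 z},
        ((((borelQuotHeight (↥(maximalRealSubfield L)) L (IsCMField.complexConj L) 2 z)⁻¹ ^ (2 * k) : ℝ≥0)) : ℝ≥0∞) *
          Φ (pZX (↥(maximalRealSubfield L)) L (IsCMField.complexConj L) 2 z) ∂μZ =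
        ∫⁻ z, Φ (pZX (↥(maximalRealSubfield L)) L (IsCMField.complexConj L) 2 z) ∂(weightedTruncMeasure (↥(maximalRealSubfield L)) L (IsCMField.complexConj L) 2 k c₀ μZ) :=
      (lintegral_weightedTruncMeasure μZ k c₀ (g := fun z => Φ (pZX (↥(maximalRealSubfield L)) L (IsCMField.complexConj L) 2 z)) (hΦm.comp measurable_pZX)).symm
    rw [lintegral_add_right _ (measurable_const.indicator (measurableSet_lt_borelQuotHeight a₀)), lintegral_const_mul' _ _ ENNReal.coe_ne_top,
      lintegral_indicator_const (measurableSet_lt_borelQuotHeight a₀), hwk]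
    exact add_le_add (mul_le_mul_of_nonneg_left (hB Φ hΦm) zero_le) (mul_le_mul_of_nonneg_left (Measure.restrict_apply_le _ _) zero_le)
  -- everything is finite
  have hfinite : A * ∫⁻ x, Φ x ∂μ < ∞ := by
    refine lt_of_le_of_lt (hlow0.trans hint) (ENNReal.add_lt_top.2 ⟨?_, ?_⟩)
    · exact ENNReal.mul_lt_top ENNReal.coe_lt_top (ENNReal.mul_lt_top (lt_top_iff_ne_top.2 hBt) hXfin)
    · exact ENNReal.mul_lt_top (ENNReal.rpow_lt_top_of_nonneg (by norm_num) ENNReal.ofReal_ne_top) (lt_top_iff_ne_top.2 hfin)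
  have hΦfin : ∫⁻ x, Φ x ∂μ < ∞ := by
    rcases ENNReal.mul_lt_top_iff.1 hfinite with h | h | h
    · exact h.2
    · exact absurd h hA0
    · rw [h]; exact ENNReal.zero_lt_top
  refine ⟨(Lp.stronglyMeasurable ψ).aestronglyMeasurable, ?_⟩
  rw [eLpNorm_eq_lintegral_rpow_enorm_toReal two_ne_zero ENNReal.ofNat_ne_top, ENNReal.toReal_ofNat]
  exact ENNReal.rpow_lt_top_of_nonneg (by norm_num) hΦfin.ne

/-! ## §4b THE CM HEAD (`N = 2`, `σ₀ = 1`): the letter `hL2` of P6′ §2 `hunq_of_memLp_two` -/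

/-- **ITEM (i) FOR THE CM PAIR AT `N = 2`: A HOMOGENEOUS SOLUTION IS IN `L²(μ)`** — the `hL2` slot of ★∕📤 P6′ §2 `hunq_of_memLp_two` BYTE-FOR-BYTE (`ι := iota hb`, `P := cnstN k a μZ`), with
the transfer discharged by §3 (★ P2a-ι comparison frame `(L μ νG hβ hμZ)`).  Remaining letters: K2's `hK1` for `h i₀` (K2E1-p11), P3-C's `hδι` (★ `deltaShift_comp_iota`), and the essential
bound `hδα₂` of `δ(α₂ z)` (§2 `exists_ae_norm_deltaShift_le_of_ae_eq_cpow` from ★ P8-β's `α₂ z =ᵐ HZ^{1−z}`).  So P8 proper's `hunq` is ★ modulo `hK1`.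
[cite: BernsteinLapid2019, §4 Claim 2 (p. 9), Claims 4–5 (p. 10)] [cite: MoeglinWaldspurger1995, I.4.10] -/
theorem hL2_cm_two
    (μ : Measure (quasiSplit (↥(maximalRealSubfield L)) L (IsCMField.complexConj L) 2).automorphicQuotient)
    [(quasiSplit (↥(maximalRealSubfield L)) L (IsCMField.complexConj L) 2).IsAutomorphicMeasure μ]
    (νG : Measure (quasiSplit (↥(maximalRealSubfield L)) L (IsCMField.complexConj L) 2).Adelic) [νG.IsHaarMeasure] [νG.IsInvInvariant]
    {β : (quasiSplit (↥(maximalRealSubfield L)) L (IsCMField.complexConj L) 2).Adelic → ℝ≥0∞}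
    (hβ : IsCoveringWeight ↥((arithmeticBorel (↥(maximalRealSubfield L)) L (IsCMField.complexConj L) 2).map
      (quasiSplit (↥(maximalRealSubfield L)) L (IsCMField.complexConj L) 2).arithmeticSubgroup.subtype) β)
    {μZ : Measure (borelQuotient (↥(maximalRealSubfield L)) L (IsCMField.complexConj L) 2)}
    (hμZ : ∀ f : borelQuotient (↥(maximalRealSubfield L)) L (IsCMField.complexConj L) 2 → ℝ≥0∞, Measurable f →
      ∫⁻ z, f z ∂μZ = ∫⁻ g, β g * f (toBorelQuotient (↥(maximalRealSubfield L)) L (IsCMField.complexConj L) 2 g) ∂νG)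
    (k n : ℕ) {I : Type*} (i₀ : I) {h : I → (quasiSplit (↥(maximalRealSubfield L)) L (IsCMField.complexConj L) 2).Adelic → ℂ}
    {a a₀ : ℝ≥0} (ha₀ : 0 < a₀) (haa₀ : a ≤ a₀) (hfin : μZ {z | a < borelQuotHeight (↥(maximalRealSubfield L)) L (IsCMField.complexConj L) 2 z} ≠ ∞)
    (hb : IotaBound (↥(maximalRealSubfield L)) L (IsCMField.complexConj L) 2 k a μ μZ)
    (hs : ShiftBound (↥(maximalRealSubfield L)) L (IsCMField.complexConj L) 2 k a a₀ νG μZ (h i₀))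
    (T : I → HX (↥(maximalRealSubfield L)) L (IsCMField.complexConj L) 2 k μ →L[ℂ] HX (↥(maximalRealSubfield L)) L (IsCMField.complexConj L) 2 k μ)
    (hδι : deltaShift hs ∘L iota hb = restrHN (↥(maximalRealSubfield L)) L (IsCMField.complexConj L) 2 k haa₀ μZ ∘L iota hb ∘L T i₀)
    {C m : ℝ} (hC : 0 ≤ C) (hm : 0 ≤ m)
    (hK1 : ∀ f : HNcusp (↥(maximalRealSubfield L)) L (IsCMField.complexConj L) 2 k a μZ,
      ∀ᵐ x ∂(weightedTruncMeasure (↥(maximalRealSubfield L)) L (IsCMField.complexConj L) 2 k a₀ μZ),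
        ‖rightConvFun (↥(maximalRealSubfield L)) L (IsCMField.complexConj L) 2 νG (h i₀)
            ((f : HN (↥(maximalRealSubfield L)) L (IsCMField.complexConj L) 2 k a μZ) : borelQuotient (↥(maximalRealSubfield L)) L (IsCMField.complexConj L) 2 → ℂ) x‖ ≤
          C * ‖f‖ * ((borelQuotHeight (↥(maximalRealSubfield L)) L (IsCMField.complexConj L) 2 x : ℝ)) ^ (-m))
    (α₂ : ℂ → HN (↥(maximalRealSubfield L)) L (IsCMField.complexConj L) 2 k a μZ)
    (hδα₂ : ∀ z ∈ ball (0 : ℂ) (n + 2), 1 < z.re → ∃ M : ℝ, ∀ᵐ x ∂(weightedTruncMeasure (↥(maximalRealSubfield L)) L (IsCMField.complexConj L) 2 k a₀ μZ),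
      ‖(deltaShift hs (α₂ z) : borelQuotient (↥(maximalRealSubfield L)) L (IsCMField.complexConj L) 2 → ℂ) x‖ ≤ M)
    {X' : Type*} [NormedAddCommGroup X'] [NormedSpace ℂ X'] (Q : HX (↥(maximalRealSubfield L)) L (IsCMField.complexConj L) 2 k μ →L[ℂ] X') :
    ∀ z ∈ ball (0 : ℂ) (n + 2), 1 < z.re → (∫ x, h i₀ x * (((borelHeight x : ℝ≥0) : ℝ) : ℂ) ^ z ∂νG).im ≠ 0 →
      ∀ (ψ : HX (↥(maximalRealSubfield L)) L (IsCMField.complexConj L) 2 k μ) (b' : ℂ),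
        (∀ i, T i ψ = (∫ x, h i x * (((borelHeight x : ℝ≥0) : ℝ) : ℂ) ^ z ∂νG) • ψ) →
          cnstN (↥(maximalRealSubfield L)) L (IsCMField.complexConj L) 2 k a μZ (iota hb ψ) = b' • α₂ z → Q ψ = 0 →
            MemLp (ψ : (quasiSplit (↥(maximalRealSubfield L)) L (IsCMField.complexConj L) 2).automorphicQuotient → ℂ) 2 μ :=
  have hfin₀ : μZ {z | a₀ < borelQuotHeight (↥(maximalRealSubfield L)) L (IsCMField.complexConj L) 2 z} ≠ ∞ :=
    ((measure_mono fun _ hz => lt_of_le_of_lt haa₀ hz).trans_lt (lt_top_iff_ne_top.2 hfin)).ne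
  hL2_of_lt 1 n i₀ ha₀ haa₀ hb hs T hδι hC hm hK1 α₂ hδα₂ (fun ψ _ hM => memLp_two_of_ae_norm_comp_pZX_le_cm L μ νG hβ hμZ k ψ ha₀ hfin₀ hM) Q

end CM

end Summit.HodgeConjecture.HodgeConjecture.Cruxes.H413.K2E1BLHomogeneousL2U2

end
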